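import Mathlib

/-!
# The flat-size bound of the Core for representable matroids (C-030, representable case)

Let `v : α → (ι → F)` be a family of vectors over a field `F`, indexed by a finite set `E ⊆ α`
(an `F`-representation of a matroid on `E`, ambient dimension `Fintype.card ι`).  Suppose every
`e ∈ E` has an `e`-free partition: some `A ⊆ E ∖ {e}` with `v e ∉ span (v '' A)` and
`v e ∉ span (v '' ((E ∖ {e}) ∖ A))` — the `e`-free clause of the cell's `Core` predicate, read
through the representation.  Then `|E| ≤ C(card ι + 1, 2)`.

Proof (quadric interpolation).  `v e ∉ span (v '' A)` gives a linear form `φ₁` vanishing on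
`v '' A` with `φ₁ (v e) ≠ 0`; likewise `φ₂` on the other part.  The quadratic form `φ₁ · φ₂`
vanishes at every `v x` with `x ≠ e` and not at `v e`, so the evaluation map from quadratic forms
(coefficients indexed by the unordered pairs `Sym2 ι`) to functions on `E` hits every `δ_e`, hence
is surjective, and `|E| ≤ Fintype.card (Sym2 ι) = C(card ι + 1, 2)`.

Paper: HOME/proofs/P3-C030-representable.md (p3 g20).
-/

namespace PercRepro
namespace RepCore

open Module Finset

variable {F : Type*} [Field F] {ι : Type*} [Fintype ι] [DecidableEq ι] {α : Type*}

/-- The monomial `w i * w j` attached to the unordered pair `s(i, j)`. -/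
def mono (w : ι → F) : Sym2 ι → F :=
  Sym2.lift ⟨fun i j => w i * w j, fun i j => mul_comm (w i) (w j)⟩

omit [Fintype ι] [DecidableEq ι] in
/-- `mono` on a pair. -/
@[simp] theorem mono_mk (w : ι → F) (i j : ι) : mono w s(i, j) = w i * w j := rfl

/-- Evaluation of the quadratic form with coefficients `c : Sym2 ι → F` at the points `v x`,
`x ∈ E`, as a linear map. -/
def ev (E : Finset α) (v : α → ι → F) : (Sym2 ι → F) →ₗ[F] (E → F) where
  toFun c x := ∑ s, c s * mono (v x) s
  map_add' c d := by
    ext x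
    simp [add_mul, Finset.sum_add_distrib]
  map_smul' a c := by
    ext x
    simp [Finset.mul_sum, mul_assoc]

/-- The coefficient vector (on unordered pairs) of the product of the two linear forms
`w ↦ ∑ i, a i * w i` and `w ↦ ∑ j, b j * w j`. -/
def prodCoeff (a b : ι → F) : Sym2 ι → F :=
  fun s => ∑ p ∈ (univ : Finset (ι × ι)).filter (fun p : ι × ι => Sym2.mk p.1 p.2 = s), a p.1 * b p.2

/-- The quadratic form with coefficients `prodCoeff a b` is the product of the two linear forms. -/
theorem ev_prodCoeff (E : Finset α) (v : α → ι → F) (a b : ι → F) (x : E) :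
    ev E v (prodCoeff a b) x = (∑ i, a i * v x i) * ∑ j, b j * v x j := by
  change ∑ s : Sym2 ι, prodCoeff a b s * mono (v x) s = _
  calc ∑ s : Sym2 ι, prodCoeff a b s * mono (v x) s
      = ∑ s : Sym2 ι, ∑ p ∈ (univ : Finset (ι × ι)).filter (fun p : ι × ι => Sym2.mk p.1 p.2 = s),
          (a p.1 * v x p.1) * (b p.2 * v x p.2) := by
        refine Finset.sum_congr rfl fun s _ => ?_
        unfold prodCoeff
        rw [Finset.sum_mul]
        refine Finset.sum_congr rfl fun p hp => ?_
        obtain ⟨i, j⟩ := p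
        have hs : s(i, j) = s := (Finset.mem_filter.1 hp).2
        rw [← hs, mono_mk]
        ring
    _ = ∑ p : ι × ι, (a p.1 * v x p.1) * (b p.2 * v x p.2) :=
        Finset.sum_fiberwise (univ : Finset (ι × ι)) (fun p : ι × ι => Sym2.mk p.1 p.2) _
    _ = ∑ i, ∑ j, (a i * v x i) * (b j * v x j) := by
        rw [Fintype.sum_prod_type]
    _ = (∑ i, a i * v x i) * ∑ j, b j * v x j := (Fintype.sum_mul_sum _ _).symm

/-- A linear form on `ι → F` is given by its coefficients on the standard basis. -/
theorem dual_apply_eq_sum (f : Module.Dual F (ι → F)) (w : ι → F) :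
    f w = ∑ i, (f fun j => if i = j then 1 else 0) * w i := by
  rw [LinearMap.pi_apply_eq_sum_univ]
  refine Finset.sum_congr rfl fun i _ => ?_
  rw [smul_eq_mul, mul_comm]

/-- **Quadric interpolation**: if every point `e ∈ E` is isolated by two linear forms — one
vanishing on `v '' A`, one on `v '' ((E ∖ {e}) ∖ A)`, both nonzero at `v e` — then the evaluation
map on quadratic forms is surjective onto the functions on `E`. -/
theorem ev_surjective (E : Finset α) (v : α → ι → F)
    (h : ∀ e ∈ E, ∃ A ⊆ (↑E : Set α) \ {e}, v e ∉ Submodule.span F (v '' A) ∧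
      v e ∉ Submodule.span F (v '' (((↑E : Set α) \ {e}) \ A))) :
    Function.Surjective (ev E v) := by
  classical
  rw [← LinearMap.range_eq_top, eq_top_iff, ← (Pi.basisFun F E).span_eq, Submodule.span_le]
  rintro _ ⟨e, rfl⟩
  rw [Pi.basisFun_apply]
  obtain ⟨A, hA, h₁, h₂⟩ := h e e.2
  obtain ⟨f₁, hf₁, hA₁⟩ := Submodule.exists_dual_map_eq_bot_of_notMem h₁ inferInstance
  obtain ⟨f₂, hf₂, hA₂⟩ := Submodule.exists_dual_map_eq_bot_of_notMem h₂ inferInstance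
  have hz₁ : ∀ x ∈ A, f₁ (v x) = 0 := fun x hx =>
    (Submodule.eq_bot_iff _).1 hA₁ _
      (Submodule.mem_map.2 ⟨v x, Submodule.subset_span (Set.mem_image_of_mem v hx), rfl⟩)
  have hz₂ : ∀ x ∈ ((↑E : Set α) \ {(e : α)}) \ A, f₂ (v x) = 0 := fun x hx =>
    (Submodule.eq_bot_iff _).1 hA₂ _
      (Submodule.mem_map.2 ⟨v x, Submodule.subset_span (Set.mem_image_of_mem v hx), rfl⟩)
  have hκ0 : f₁ (v e) * f₂ (v e) ≠ 0 := mul_ne_zero hf₁ hf₂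
  -- the evaluated quadratic form is `(f₁ (v e) * f₂ (v e)) • δ_e`
  have hev : ev E v (prodCoeff (fun i => f₁ fun j => if i = j then 1 else 0)
      (fun i => f₂ fun j => if i = j then 1 else 0)) = (f₁ (v e) * f₂ (v e)) • Pi.single e (1 : F) := by
    ext x
    rw [ev_prodCoeff, ← dual_apply_eq_sum, ← dual_apply_eq_sum, Pi.smul_apply, Pi.single_apply]
    by_cases hx : x = e
    · rw [if_pos hx, hx, smul_eq_mul, mul_one]
    · rw [if_neg hx, smul_zero]
      have hxe : (x : α) ∈ ((↑E : Set α) \ {(e : α)}) := by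
        refine ⟨x.2, fun hxe => hx ?_⟩
        exact Subtype.ext (Set.mem_singleton_iff.1 hxe)
      by_cases hxA : (x : α) ∈ A
      · rw [hz₁ _ hxA, zero_mul]
      · rw [hz₂ _ ⟨hxe, hxA⟩, mul_zero]
  refine ⟨(f₁ (v e) * f₂ (v e))⁻¹ • prodCoeff (fun i => f₁ fun j => if i = j then 1 else 0)
    (fun i => f₂ fun j => if i = j then 1 else 0), ?_⟩
  rw [map_smul, hev, smul_smul, inv_mul_cancel₀ hκ0, one_smul]

/-- **C-030, representable case.**  A finite family of vectors `v : E → (ι → F)` in which every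
point has an `e`-free partition (the `Core` clause read through the representation) has at most
`C(card ι + 1, 2)` members. -/
theorem card_le_choose (E : Finset α) (v : α → ι → F)
    (h : ∀ e ∈ E, ∃ A ⊆ (↑E : Set α) \ {e}, v e ∉ Submodule.span F (v '' A) ∧
      v e ∉ Submodule.span F (v '' (((↑E : Set α) \ {e}) \ A))) :
    E.card ≤ (Fintype.card ι + 1).choose 2 := by
  classical
  have hle := LinearMap.finrank_le_finrank_of_surjective (ev_surjective E v h)
  rw [Module.finrank_fintype_fun_eq_card, Module.finrank_fintype_fun_eq_card, Fintype.card_coe,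
    Sym2.card] at hle
  exact hle

/-- The matroid form: `M` a matroid on the finite ground set `E`, `v` a closure-representation of
`M` over `F` (`x ∈ cl X ↔ v x ∈ span (v '' X)` on the ground set), and every element with an
`e`-free partition (the last clause of the cell's `Core M p`).  Then `|E| ≤ C(card ι + 1, 2)`. -/
theorem card_le_choose_of_matroid (M : Matroid α) (E : Finset α) (hE : M.E = ↑E) (v : α → ι → F)
    (hrep : ∀ X ⊆ M.E, ∀ x ∈ M.E, (x ∈ M.closure X ↔ v x ∈ Submodule.span F (v '' X)))
    (hcore : ∀ e ∈ M.E, ∃ A ⊆ M.E \ {e}, e ∉ M.closure A ∧ e ∉ M.closure ((M.E \ {e}) \ A)) :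
    E.card ≤ (Fintype.card ι + 1).choose 2 := by
  refine card_le_choose E v fun e he => ?_
  have heM : e ∈ M.E := by rw [hE]; exact_mod_cast he
  obtain ⟨A, hA, h₁, h₂⟩ := hcore e heM
  have hA' : A ⊆ M.E := hA.trans Set.sdiff_subset
  have hB' : (M.E \ {e}) \ A ⊆ M.E := Set.sdiff_subset.trans Set.sdiff_subset
  refine ⟨A, by rw [← hE]; exact hA, ?_, ?_⟩
  · exact fun hmem => h₁ ((hrep A hA' e heM).2 hmem)
  · rw [← hE]
    exact fun hmem => h₂ ((hrep _ hB' e heM).2 hmem)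

end RepCore
end PercRepro
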